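import Summits.HodgeConjecture.HodgeConjecture.Theorems.F0P6aDatumOfInputsDefs
import Literature.AlgebraicGeometry.AbelianSchemes.RoofLegsSpecialFibreKernelRowsFin
import Literature.AlgebraicGeometry.AbelianSchemes.RoofLegsIsogenyOfPolarization
import HarnessLib
import HarnessLib.Audit.LibrarySuggestionsDenyListCruxes

/-!
# `F0P6aStubFROBRoofLegsKernelRows` — ★ RE-HOME of the crux workfile `Lines/F0_P6a_StubFROBRoofLegs.lean` (tree sha16 082e2a3dbd17c2a8, 407 l., 4 declaration commands, code-`sorry`-free), PART 1 of 2

This `Theorems/` module is the TREE BYTES of that workfile with the NAMESPACE KEPT, so every fully-qualified name is UNCHANGED; only this module docstring is re-headed,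
the `Lines` imports are switched to their ★ re-homed twins — `Lines.F0_P6a_DatumOfInputs` → ★ `Theorems.F0P6aDatumOfInputsDefs` — and the audit carrier `LibrarySuggestionsDenyListCruxes` is CARRIED on this root part (bare import, LEAD «M-142d» (1) rule «P-κ»; parts 2…n inherit it transitively)
Why a re-home: a `Theorems/` file cannot import a `Lines/` workfile (F0P6-ref1 o-6), and closing stmt-HodgeConjecture-24832 `--as proved --by <Theorems decl>` at rung 0 needs the
sorry-free `Lines` chain behind the gate (RE-HOME TABLE v1.7, LA7-plan (g7); PLAN «L3 cone RE-HOME» v1, LA3-plan (g5); LEAD F0P6-plan (g5) «M-140» (1)∕(4), 2026-09-02).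
SIZE LINT (`Theorems/` files with proofs ≤ 400 l.): the workfile is cut into 2 consecutive parts `F0P6aStubFROBRoofLegsKernelRows` → `F0P6aStubFROBRoofLegs`; this is PART 1 (tree lines :1–:312); each later part imports the previous one and re-opens the scopes open at its cut with their `variable`∕`open`∕`set_option` lines replayed verbatim; the LAST part `F0P6aStubFROBRoofLegs` is the module the `Lines/` shim and consumers import.
After the chain is ★ the `Lines` workfile becomes a one-import SHIM of `F0P6aStubFROBRoofLegs` (a `Lines/` write, batched per cone on the LEAD՚s word), so no environment holds two copies (NO-CROSS-IMPORT).
It asserts nothing beyond what the workfile already proves.  HC_CM is proved only modulo the 7 printed citations (2 remaining: hLiu418 = stmt-HodgeConjecture-24832, h413 = stmt-HodgeConjecture-24833) until rung 0 closes; a re-home is count-neutral.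

## Original module docstring (verbatim)
# F0 · P6a — `stub_FROB` ROOF road, W1-a: THE REDUCED ROOF LEG AT THE D-LINE BINDERS WITH ITS KERNEL ROWS, IN ONE ∃ (leaflet ED. 1 cand; pen LA1-p04 (g3))

`crux_decl: Summit.HodgeConjecture.HodgeConjecture.Theses.HCCMUnconditional.HLiu418`.  Cell `hodgecm-mathlib` (D-0151), «GO 500» half A line L3 (socket `stub_FROB` of the
D-line `Lines/F0_P6a_DatumOfInputs.lean` :554; L3 closer leaf `Lines/F0_P6a_StubFROB.lean`, socket `stub_ROOF0` → W5 `stub_ROOFGEO`); LA3-plan (g2) «W1 FINAL CUT (rule 27)»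
2026-09-02T09:11:27Z: W1-a = this file (pen LA1-p04 (g3)), W1-b = `Lines/F0_P6a_StubFROBRoofMiddleDual.lean` (pen LA3-p01 (g2): the downstairs dual of the middle,
(K1) `kernelUpperBound₀`, `roof₀_of_rows₀`).  CONTENT (RULING (γ1) «ONE ∃, ONE ROOF DOWNSTAIRS»): from `I : RGDInputsAt …`, a Serre presentation `(E′, P, Q)` of `𝔭_w⁻¹` with
scalar `p`, the unit pin `hD` of `I.dual` and the letter `RoofLink I quotΩ`, for every `y`, `L`: the `RoofLink` subgroup `K` with its line clause, the UPSTAIRS roof's own witnesses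
`B, DB, λ_B, q, c` with (r1)–(r5) VERBATIM, and the REDUCED LEG `q̄ : (I.univ ×_𝓨 𝓨_s)_{red₀ y} → (𝒞 ×_𝓨 𝓨_s)_{red₀ (quotΩ y L)}` (`𝒞 = I.univ ⊗ 𝔭_w⁻¹`) with (r1₀) flat ∧ surjective,
(r4₀-q), (r5₀-q), (r3₀-q) for EVERY downstairs `(DB̄, λ_B̄)` with `c̄^*λ_B̄ = λ ≫ [p]` (W1-b supplies one), and the KERNEL ROWS of ★ `RoofLegsSpecialFibreKernelRowsFin` (LA1-p04 (g3),
p849862∕p849949∕p850066∕p850294∕p850352) for THE SAME `q̄`: (K3₀) «model KILL»: a flat `𝒦 ↪ I.univ_ỹ` over `𝒪_Ω̄` whose generic fibre `q` kills has its special fibre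
killed by `q̄` (three-piece-iso spelling = (KEW) `Lines/F0_P6a_KillEngineW.lean` `…_of_kerRow`'s `hK3` VERBATIM — W5 passes it as `hK3`), (K2₀) «`Ker q(Ω̄) ⊆ A_y[𝔞](Ω̄)` ⇒ `Ker q̄ ⊆ A_{red₀ y}[𝔞]` on all `T`-points» (every ideal
`𝔞`; at `𝔭_w·𝔭_{c•w}` = W3∕W5's `hker`, fed through (r1) by L2's ★ `isIdealTorsion_mul_of_roof`), (K4₀) `deg q̄ = deg q`, (FIN₀) `q̄` finite, (RK₀) `rk Γ(Ker q̄) = #Ker q(Ω̄)`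
(= `#K` by (r1); with L2's `#K = q²`, LEAD «M-73», this is W7's `hrkK`).  Decls: (a) `roofΩ_legs_isFinite_surjective` (★ organ #4 at the D-line carriers), (b′)
`exists_roofLeg_of_legs_kerRows` (★ `…_kerRowsFin` at the D-line carriers), (c′) `exists_roofLeg_of_roofΩ_kerRows` (from `RoofΩ`, one ∃), head′ `roofLegs_of_roofLink_kerRows`
(from `RoofLink`, `red₀Of` currency); every decl ≤ 400 000 heartbeats (cand v5: + (K3₀) per LA3-plan (g2) RULE 29 (2) ∕ LA3-p03 (g4) FINDING 2; (b′) in ★'s currency,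
the currency conversions in (c′) — the measured budget split).
Lineage: (a)(b) and the binder texts are LA3-p01 (g0∕g2)'s (v3 b40ce4cd∕1a1526b3); the kernel rows, (c′), head′ are LA1-p04 (g3)'s.  HOME-first cand: NO `crux write` by an
L-seat; box (LA-ref1) → LA3-plan writes.  HC_CM is proved only modulo the 7 printed citations (2 remaining named inputs hLiu418 24832, h413 24833) until rung 0 closes; count-neutral.
[cite: Liu2021, Prop. D.8 (3) p. 135, pp. 136–138] [cite: RapoportSmithlingZhang2020Diagonal, §4.1 p. 17; §4.3 (4.23) p. 21] [cite: MumfordAV1970, §7 Thm. 4 p. 72; §15 Thm. 1 p. 143; §23 Thm. 2 p. 231]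
[cite: SerreTate1968, §1] [cite: Conrad2004GrossZagier, §7 Thm. 7.5] [cite: Kottwitz1992, §5, pp. 390–391] [cite: BoschLutkebohmertRaynaud1990, §7.3 Prop. 6 (p. 180)]
-/

set_option autoImplicit false

noncomputable section

namespace Summit.HodgeConjecture.HodgeConjecture.Cruxes.HLiu418.F0P6aStubFROBRoofLegs

set_option linter.dupNamespace false  -- `Summit.HodgeConjecture.HodgeConjecture.…` BY DESIGN (D-0017)

open CategoryTheory CategoryTheory.Limits NumberField IsDedekindDomain MulAction AlgebraicGeometry
open scoped Matrix Pointwise MonObj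
open Literature.NumberTheory.GaloisRepresentations
open Literature.NumberTheory.Automorphic Literature.NumberTheory.Automorphic.UnitaryGroup
open Literature.AlgebraicGeometry.ShimuraVarieties.UnitaryCanonicalModel
open Literature.NumberTheory.Automorphic.Liu2021.AppendixC
open Literature.AlgebraicGeometry.Motives (AlgPoints IntegralModel SchemeOver thickening thickeningLift specOver relFrobeniusOver frobSpec)
open Literature.NumberTheory.DiophantineGeometry (geomResidueField specialFibreFunctor specResidueField)
open Literature.AlgebraicGeometry.RelativeSpec (ActionOver)
open Literature.NumberTheory.EllipticCurves (genericFibre specGenericPoint)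
open Literature.AlgebraicGeometry.AbelianSchemes Literature.AlgebraicGeometry.AbelianSchemes.AbelianSchemeOver
open Summit.HodgeConjecture.HodgeConjecture.Cruxes.HLiu418.F0P6aModuliDatumDefs
open Summit.HodgeConjecture.HodgeConjecture.Cruxes.HLiu418.F0P6aRGDAssembly
open Summit.HodgeConjecture.HodgeConjecture.Cruxes.HLiu418.F0P6aDatumOfInputs

set_option backward.isDefEq.respectTransparency false

variable {F : Type} [Field F] [NumberField F] [IsCMField F] {ι₁ : F →+* ℂ}
    {Jstar : Matrix (Fin 2) (Fin 2) F}
    {K₀ : C5.OpenCompactSubgroup ↥(finAdelic ↥(maximalRealSubfield F) F (IsCMField.complexConj F) 2 Jstar)}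
    {S : RecordSystemGS F Jstar ι₁ K₀} {hU7ₛ : S.HeckeTranslateDefinedOver}
    {hJ : (Jstar.map (IsCMField.complexConj F))ᵀ = Jstar} {hJu : IsUnit Jstar}
    {Fi : Type} [Field Fi] [Algebra F Fi] {Kc : C5.SmallLevel K₀} {G : Type} [Group G]
    {𝓜 : IntegralModel (𝓞 F) F ((thickening F Fi).obj (S.M.obj Kc))}
    {w : HeightOneSpectrum (𝓞 F)} {hw : (IsCMField.complexConj F) • w ≠ w} {h𝓨 : (𝓜.localise w).IsSmoothProper 1}
    {θ : ActionOver (𝓜.localise w).total.hom ((Fi ≃ₐ[F] Fi) × G)}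
    {e : Fi →ₐ[F] AlgebraicClosure (w.adicCompletion F)}

/-! ### §1 The upstairs legs are isogenies (★ organ #4 at the D-line carriers; LA3-p01 (g0)) -/

set_option maxHeartbeats 400000 in
/-- (a) **THE UPSTAIRS LEGS ARE ISOGENIES** (★ `roof_legs_isFinite_surjective_of_polarization` at the D-line carriers): from (r2), (r3)-q, `c` surjective, `I.relDim` and `p ∈ 𝔭_w`.
[cite: MumfordAV1970, §19 Thm. 1 (p. 174)] [cite: GortzWedhorn2023, Prop. 27.176 and Cor. 27.177] -/
theorem roofΩ_legs_isFinite_surjective (I : RGDInputsAt F ι₁ Jstar K₀ S hU7ₛ hJ hJu Fi Kc G 𝓜 w hw h𝓨 θ e)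
    (hD : Nonempty ((Scheme.Modules.pullback (DualPair.unitHatSlice I.dual)).obj I.dual.P ≅ SheafOfModules.unit _))
    (y y'' : AlgPoints (S.M.obj Kc) (AlgebraicClosure (w.adicCompletion F)))
    {B : AbelianSchemeOver (Spec (CommRingCat.of (AlgebraicClosure (w.adicCompletion F))))}
    (DB : B.DualPair) (lamB : B.X ⟶ DB.hat.X) [IsMonHom lamB]
    (hDBu : Nonempty ((Scheme.Modules.pullback DB.unitHatSlice).obj DB.P ≅ SheafOfModules.unit _))
    (q : (schΩOf S Kc 𝓜 w e I.univ y).X ⟶ B.X) [IsMonHom q] (c : (schΩOf S Kc 𝓜 w e I.univ y'').X ⟶ B.X) [IsMonHom c]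
    (hr2 : ∀ Pt : (fibreΩOf S Kc 𝓜 w e I.univ y'').Points (AlgebraicClosure (w.adicCompletion F)),
        (AlgPoints.map c Pt : B.toAffine.toAbelianVariety.Points (AlgebraicClosure (w.adicCompletion F))) = 1 ↔ IsIdealTorsionΩ S Kc 𝓜 w e I.univ I.act y'' w.asIdeal Pt)
    (hcsurj : Function.Surjective c.left.base)
    (hr3q : q ≫ lamB ≫ DualPair.dualIsogenyOver q (dualΩOf S Kc 𝓜 w e I.univ I.dual y) DB =
      (polΩOf S Kc 𝓜 w e I.univ I.pol y).lam ≫ (dualΩOf S Kc 𝓜 w e I.univ I.dual y).hat.mulN I.pChar) :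
    Surjective q.left ∧ IsFinite q.left ∧ Surjective c.left := by
  have hN : I.pChar ≠ 0 := I.hpChar.1.ne_zero
  have hDx := DualPair.nonempty_unitHatSlice_baseChange_iso (g := (thickeningLift e (S.M.obj Kc) y).left) _
    (DualPair.nonempty_unitHatSlice_baseChange_iso (g := ((𝓜.localise w).genericIso'.inv.left ≫ pullback.fst (𝓜.localise w).total.hom (specGenericPoint (HeightOneSpectrum.valuationSubringAtPrime F w) F))) I.dual hD)
  have hker' : ∀ Pt, (AlgPoints.map c Pt : B.toAffine.toAbelianVariety.Points (AlgebraicClosure (w.adicCompletion F))) = 1 →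
      ∀ r ∈ w.asIdeal, (AlgPoints.map (((I.act.baseChange ((𝓜.localise w).genericIso'.inv.left ≫ pullback.fst (𝓜.localise w).total.hom (specGenericPoint (HeightOneSpectrum.valuationSubringAtPrime F w) F))).baseChange (thickeningLift e (S.M.obj Kc) y'').left).i r) Pt :
        ((I.univ.baseChange ((𝓜.localise w).genericIso'.inv.left ≫ pullback.fst (𝓜.localise w).total.hom (specGenericPoint (HeightOneSpectrum.valuationSubringAtPrime F w) F))).baseChange (thickeningLift e (S.M.obj Kc) y'').left).toAffine.toAbelianVariety.Points (AlgebraicClosure (w.adicCompletion F))) = 1 :=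
    fun Pt hPt => (hr2 Pt).1 hPt
  obtain ⟨hqsurj, hqfin, hcsurj', -⟩ := roof_legs_isFinite_surjective_of_polarization (A := I.univ) (gA := I.g) (B := B) (O := 𝓞 F)
    (Ω := (AlgebraicClosure (w.adicCompletion F))) ((𝓜.localise w).genericIso'.inv.left ≫ pullback.fst (𝓜.localise w).total.hom (specGenericPoint (HeightOneSpectrum.valuationSubringAtPrime F w) F))
    (thickeningLift e (S.M.obj Kc) y).left (thickeningLift e (S.M.obj Kc) y'').left I.relDim I.act I.dual I.pol DB hDBu hDx q c lamB hN hr3q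
    hN I.hpChar.2 hker' hcsurj
  exact ⟨hqsurj, hqfin, hcsurj'⟩

/-! ### §2 The reduced leg with its kernel rows — (b′) at the D-line carriers, (c′) from `RoofΩ` in ONE ∃, head′ from `RoofLink` -/

section KernelRows

open Literature.NumberTheory.DiophantineGeometry
open Literature.AlgebraicGeometry.Motives (extendPoint specValuationSubring specFractionFieldι specRingHomι)

set_option maxHeartbeats 400000 in
/-- (b′) **★ `exists_roofLeg_specialFibre_of_downstairsDual_kerRowsFin` AT THE D-LINE CARRIERS, IN ★'s OWN CURRENCY**: the hypotheses (r2)(r3q)(r3c)(r4)(r5) are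
★'s binder texts instantiated at `𝒜 := I.univ`, `𝓨 := 𝓜.localise w`, `x := thickeningLift e (S.M.obj Kc) y`, `D := I.dual`, `pol := I.pol`, `τ := I.lvl.section_`,
`N := I.pChar`, `𝔭 := w.asIdeal` (the conversion from the D-line currency `IsIdealTorsionΩ`∕`polΩOf`∕`dualΩOf`∕`actΩOf`∕`lvlPtΩOf` is paid ONCE in (c′) —
BUDGET: this decl is the bare ★ call; with the conversions inside it measured 402 441 heartbeats), and the conclusion is ★'s: the four rows (r1₀)(r4₀-q)(r5₀-q)
(r3₀-q ∀) + the exported rows (K3₀) (K2₀) (K4₀) (FIN₀) (RK₀) of ★ `RoofLegsSpecialFibreKernelRowsFin` (LA1-p04 (g3) p850352) for THE SAME `q̄`, in ★'s currency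
(`(𝓜.localise w).geomReductionMap (thickeningLift …)` = `red₀Of` unfolded; (r5₀) printed with the `𝒞`-section `lvl(a) ≫ ψ_P` on the right — ★
`map_coverLeg_restrictPt_sectionBaseChange` rewrites it to `c̄(σ^a(red₀ y″))`, `Roof₀`'s shape).
[cite: Liu2021, Prop. D.8 (3) p. 135, pp. 136–138] [cite: SerreTate1968, §1] [cite: MumfordAV1970, §23 Thm. 2 (p. 231)] -/
theorem exists_roofLeg_of_legs_kerRows (I : RGDInputsAt F ι₁ Jstar K₀ S hU7ₛ hJ hJu Fi Kc G 𝓜 w hw h𝓨 θ e)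
    {m : ℕ} (E' : Matrix (Fin m) (Fin m) (𝓞 F)) (hE' : E' * E' = E') (P : Matrix (Fin m) (Fin 1) (𝓞 F)) (Q : Matrix (Fin 1) (Fin m) (𝓞 F))
    (hP : E' * P = P) (hQ : Q * E' = Q) (hQP : Q * P = Matrix.scalar (Fin 1) (I.pChar : 𝓞 F))
    (hPQ : P * Q = Matrix.scalar (Fin m) (I.pChar : 𝓞 F) * E') (h𝔭 : Ideal.span (Set.range fun k => P k 0) = w.asIdeal)
    (hD : Nonempty ((Scheme.Modules.pullback (DualPair.unitHatSlice I.dual)).obj I.dual.P ≅ SheafOfModules.unit _))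
    (y y'' : AlgPoints (S.M.obj Kc) (AlgebraicClosure (w.adicCompletion F)))
    {B : AbelianSchemeOver (Spec (CommRingCat.of (AlgebraicClosure (w.adicCompletion F))))}
    (DB : B.DualPair) (lamB : B.X ⟶ DB.hat.X) [IsMonHom lamB]
    (hDBu : Nonempty ((Scheme.Modules.pullback DB.unitHatSlice).obj DB.P ≅ SheafOfModules.unit _))
    (q : (schΩOf S Kc 𝓜 w e I.univ y).X ⟶ B.X) [IsMonHom q] (c : (schΩOf S Kc 𝓜 w e I.univ y'').X ⟶ B.X) [IsMonHom c]
    [IsFinite q.left] [Surjective q.left] [Surjective c.left]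
    -- (r2) the kernel of `c` on `Ω̄`-points is the `𝔭`-torsion
    (hr2 : ∀ Pt : ((I.univ.baseChange ((𝓜.localise w).genericIso'.inv.left ≫ pullback.fst (𝓜.localise w).total.hom (specGenericPoint (HeightOneSpectrum.valuationSubringAtPrime F w) F))).baseChange
        (thickeningLift e (S.M.obj Kc) y'').left).toAffine.toAbelianVariety.Points (AlgebraicClosure (w.adicCompletion F)),
      (AlgPoints.map c Pt : B.toAffine.toAbelianVariety.Points (AlgebraicClosure (w.adicCompletion F))) = 1 ↔
        ∀ a ∈ w.asIdeal, (AlgPoints.map (((I.act.baseChange ((𝓜.localise w).genericIso'.inv.left ≫ pullback.fst (𝓜.localise w).total.hom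
            (specGenericPoint (HeightOneSpectrum.valuationSubringAtPrime F w) F))).baseChange (thickeningLift e (S.M.obj Kc) y'').left).i a) Pt :
          ((I.univ.baseChange ((𝓜.localise w).genericIso'.inv.left ≫ pullback.fst (𝓜.localise w).total.hom (specGenericPoint (HeightOneSpectrum.valuationSubringAtPrime F w) F))).baseChange
            (thickeningLift e (S.M.obj Kc) y'').left).toAffine.toAbelianVariety.Points (AlgebraicClosure (w.adicCompletion F))) = 1)
    -- (r3) the polarisation laws of the two legs through the dual homomorphism `λ_B`
    (hr3q : q ≫ lamB ≫ DualPair.dualIsogenyOver q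
        ((I.dual.baseChange ((𝓜.localise w).genericIso'.inv.left ≫ pullback.fst (𝓜.localise w).total.hom (specGenericPoint (HeightOneSpectrum.valuationSubringAtPrime F w) F))).baseChange (thickeningLift e (S.M.obj Kc) y).left) DB =
      ((I.pol.baseChange ((𝓜.localise w).genericIso'.inv.left ≫ pullback.fst (𝓜.localise w).total.hom (specGenericPoint (HeightOneSpectrum.valuationSubringAtPrime F w) F))).baseChange (thickeningLift e (S.M.obj Kc) y).left).lam ≫
        ((I.dual.baseChange ((𝓜.localise w).genericIso'.inv.left ≫ pullback.fst (𝓜.localise w).total.hom (specGenericPoint (HeightOneSpectrum.valuationSubringAtPrime F w) F))).baseChange (thickeningLift e (S.M.obj Kc) y).left).hat.mulN I.pChar)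
    (hr3c : c ≫ lamB ≫ DualPair.dualIsogenyOver c
        ((I.dual.baseChange ((𝓜.localise w).genericIso'.inv.left ≫ pullback.fst (𝓜.localise w).total.hom (specGenericPoint (HeightOneSpectrum.valuationSubringAtPrime F w) F))).baseChange (thickeningLift e (S.M.obj Kc) y'').left) DB =
      ((I.pol.baseChange ((𝓜.localise w).genericIso'.inv.left ≫ pullback.fst (𝓜.localise w).total.hom (specGenericPoint (HeightOneSpectrum.valuationSubringAtPrime F w) F))).baseChange (thickeningLift e (S.M.obj Kc) y'').left).lam ≫
        ((I.dual.baseChange ((𝓜.localise w).genericIso'.inv.left ≫ pullback.fst (𝓜.localise w).total.hom (specGenericPoint (HeightOneSpectrum.valuationSubringAtPrime F w) F))).baseChange (thickeningLift e (S.M.obj Kc) y'').left).hat.mulN I.pChar)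
    -- (r4) common intertwiners
    (hr4 : ∀ a : 𝓞 F, ∃ b : B.X ⟶ B.X,
      ((I.act.baseChange ((𝓜.localise w).genericIso'.inv.left ≫ pullback.fst (𝓜.localise w).total.hom (specGenericPoint (HeightOneSpectrum.valuationSubringAtPrime F w) F))).baseChange (thickeningLift e (S.M.obj Kc) y).left).i a ≫ q =
          q ≫ b ∧
        ((I.act.baseChange ((𝓜.localise w).genericIso'.inv.left ≫ pullback.fst (𝓜.localise w).total.hom (specGenericPoint (HeightOneSpectrum.valuationSubringAtPrime F w) F))).baseChange (thickeningLift e (S.M.obj Kc) y'').left).i a ≫ c =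
          c ≫ b)
    -- (r5) level points correspond
    (hr5 : ∀ i : Fin I.g ⊕ Fin I.g → ZMod I.N,
      (AlgPoints.map q ((I.univ.baseChange ((𝓜.localise w).genericIso'.inv.left ≫ pullback.fst (𝓜.localise w).total.hom (specGenericPoint (HeightOneSpectrum.valuationSubringAtPrime F w) F))).restrictPt (thickeningLift e (S.M.obj Kc) y).left
          (I.univ.sectionBaseChange ((𝓜.localise w).genericIso'.inv.left ≫ pullback.fst (𝓜.localise w).total.hom (specGenericPoint (HeightOneSpectrum.valuationSubringAtPrime F w) F)) (I.lvl.section_ i))) :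
          B.toAffine.toAbelianVariety.Points (AlgebraicClosure (w.adicCompletion F))) =
        AlgPoints.map c ((I.univ.baseChange ((𝓜.localise w).genericIso'.inv.left ≫ pullback.fst (𝓜.localise w).total.hom (specGenericPoint (HeightOneSpectrum.valuationSubringAtPrime F w) F))).restrictPt (thickeningLift e (S.M.obj Kc) y'').left
          (I.univ.sectionBaseChange ((𝓜.localise w).genericIso'.inv.left ≫ pullback.fst (𝓜.localise w).total.hom (specGenericPoint (HeightOneSpectrum.valuationSubringAtPrime F w) F)) (I.lvl.section_ i)))) :
    haveI := I.comm
    haveI : IsProper (𝓜.localise w).total.hom := h𝓨.2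
    ∃ (qbar : ((I.univ.baseChange (pullback.fst (𝓜.localise w).total.hom (specResidueField w))).baseChange ((𝓜.localise w).geomReductionMap (thickeningLift e (S.M.obj Kc) y)).left).X ⟶
               (((serreTensor I.act E' hE').baseChange (pullback.fst (𝓜.localise w).total.hom (specResidueField w))).baseChange ((𝓜.localise w).geomReductionMap (thickeningLift e (S.M.obj Kc) y'')).left).X)
      (_ : IsMonHom qbar),
      (Flat qbar.left ∧ Function.Surjective qbar.left.base) ∧
      (∀ a : 𝓞 F, ((I.act.baseChange (pullback.fst (𝓜.localise w).total.hom (specResidueField w))).baseChange ((𝓜.localise w).geomReductionMap (thickeningLift e (S.M.obj Kc) y)).left).i a ≫ qbar =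
        qbar ≫ (((serreAction I.act E' hE').baseChange (pullback.fst (𝓜.localise w).total.hom (specResidueField w))).baseChange ((𝓜.localise w).geomReductionMap (thickeningLift e (S.M.obj Kc) y'')).left).i a) ∧
      (∀ a : Fin I.g ⊕ Fin I.g → ZMod I.N,
        AlgPoints.map qbar ((I.univ.baseChange (pullback.fst (𝓜.localise w).total.hom (specResidueField w))).restrictPt ((𝓜.localise w).geomReductionMap (thickeningLift e (S.M.obj Kc) y)).left
            (I.univ.sectionBaseChange (pullback.fst (𝓜.localise w).total.hom (specResidueField w)) (I.lvl.section_ a))) =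
          ((serreTensor I.act E' hE').baseChange (pullback.fst (𝓜.localise w).total.hom (specResidueField w))).restrictPt ((𝓜.localise w).geomReductionMap (thickeningLift e (S.M.obj Kc) y'')).left
            ((serreTensor I.act E' hE').sectionBaseChange (pullback.fst (𝓜.localise w).total.hom (specResidueField w)) (I.lvl.section_ a ≫ serreTranslate I.act E' hE' P))) ∧
      (∀ (DBs : (((serreTensor I.act E' hE').baseChange (pullback.fst (𝓜.localise w).total.hom (specResidueField w))).baseChange ((𝓜.localise w).geomReductionMap (thickeningLift e (S.M.obj Kc) y'')).left).DualPair)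
        (_ : Nonempty ((Scheme.Modules.pullback (DualPair.unitHatSlice DBs)).obj DBs.P ≅ SheafOfModules.unit _))
        (lamBs : (((serreTensor I.act E' hE').baseChange (pullback.fst (𝓜.localise w).total.hom (specResidueField w))).baseChange ((𝓜.localise w).geomReductionMap (thickeningLift e (S.M.obj Kc) y'')).left).X ⟶ DBs.hat.X) [IsMonHom lamBs],
        (haveI := isMonHom_coverLeg (pullback.fst (𝓜.localise w).total.hom (specResidueField w)) ((𝓜.localise w).geomReductionMap (thickeningLift e (S.M.obj Kc) y'')).left I.act E' hE' P
         baseChangeHom (baseChangeHom (serreTranslate I.act E' hE' P) (pullback.fst (𝓜.localise w).total.hom (specResidueField w))) ((𝓜.localise w).geomReductionMap (thickeningLift e (S.M.obj Kc) y'')).left ≫ lamBs ≫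
            DualPair.dualIsogenyOver (baseChangeHom (baseChangeHom (serreTranslate I.act E' hE' P) (pullback.fst (𝓜.localise w).total.hom (specResidueField w))) ((𝓜.localise w).geomReductionMap (thickeningLift e (S.M.obj Kc) y'')).left) ((I.dual.baseChange (pullback.fst (𝓜.localise w).total.hom (specResidueField w))).baseChange ((𝓜.localise w).geomReductionMap (thickeningLift e (S.M.obj Kc) y'')).left) DBs =
          ((I.pol.baseChange (pullback.fst (𝓜.localise w).total.hom (specResidueField w))).baseChange ((𝓜.localise w).geomReductionMap (thickeningLift e (S.M.obj Kc) y'')).left).lam ≫ ((I.dual.baseChange (pullback.fst (𝓜.localise w).total.hom (specResidueField w))).baseChange ((𝓜.localise w).geomReductionMap (thickeningLift e (S.M.obj Kc) y'')).left).hat.mulN I.pChar) →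
        qbar ≫ lamBs ≫ DualPair.dualIsogenyOver qbar ((I.dual.baseChange (pullback.fst (𝓜.localise w).total.hom (specResidueField w))).baseChange ((𝓜.localise w).geomReductionMap (thickeningLift e (S.M.obj Kc) y)).left) DBs =
          ((I.pol.baseChange (pullback.fst (𝓜.localise w).total.hom (specResidueField w))).baseChange ((𝓜.localise w).geomReductionMap (thickeningLift e (S.M.obj Kc) y)).left).lam ≫ ((I.dual.baseChange (pullback.fst (𝓜.localise w).total.hom (specResidueField w))).baseChange ((𝓜.localise w).geomReductionMap (thickeningLift e (S.M.obj Kc) y)).left).hat.mulN I.pChar) ∧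
      -- (K3₀) model KILL along a flat `𝒦 ↪ I.univ_ỹ` over `R = 𝒪_Ω̄` (`ỹ := extendPoint … (ℓ_e y)` the `R`-point extending `y` = LS `liftOf`): if `𝒦_η`, read in `A_y` through ★ (d5)'s three-piece
      -- isomorphism (= LS `isoGenericOf` by `hσΩ`), is killed by the LEG `q`, then `𝒦_s`, read in `sch₀Of … (red₀ y)` (= LS `isoSpecialOf` by `hσκ`), is killed by `q̄` — EXACTLY (KEW) `…_of_kerRow`'s `hK3`
      (∀ (𝒦 : Over (Spec (.of (closureValuationSubring (w.adicCompletion F))))) (incl : 𝒦 ⟶ (I.univ.baseChange (extendPoint (closureValuationSubring (w.adicCompletion F)) (toClosureValuationSubring w) (𝓜.localise w).total ((𝓜.localise w).modelPointsEquiv.symm (thickeningLift e (S.M.obj Kc) y))).left).X) [Flat 𝒦.hom],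
        ((Over.pullback (specFractionFieldι (closureValuationSubring (w.adicCompletion F)) (toClosureValuationSubring w)).left).map incl ≫
            (I.univ.fibreBaseChangeIso ((𝓜.localise w).genericIso'.inv.left ≫ pullback.fst (𝓜.localise w).total.hom (specGenericPoint (HeightOneSpectrum.valuationSubringAtPrime F w) F)) (thickeningLift e (S.M.obj Kc) y).left ≪≫ I.univ.fibreCongrPtIso ((𝓜.localise w).left_specFractionFieldι_comp_extendPoint_modelPointsEquiv_symm (thickeningLift e (S.M.obj Kc) y)).symm ≪≫ (I.univ.fibreBaseChangeIso (extendPoint (closureValuationSubring (w.adicCompletion F)) (toClosureValuationSubring w) (𝓜.localise w).total ((𝓜.localise w).modelPointsEquiv.symm (thickeningLift e (S.M.obj Kc) y))).left (specFractionFieldι (closureValuationSubring (w.adicCompletion F)) (toClosureValuationSubring w)).left).symm).inv.hom.hom.hom) ≫ q = 1 →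
        ((Over.pullback ((geomClosedPointIsoSpecResidueField w).inv.left ≫ (specRingHomι (closureValuationSubring (w.adicCompletion F)) (toClosureValuationSubring w) (IsLocalRing.residue (closureValuationSubring (w.adicCompletion F)))).left)).map incl ≫
            (I.univ.fibreBaseChangeIso (pullback.fst (𝓜.localise w).total.hom (specResidueField w)) ((𝓜.localise w).geomReductionMap (thickeningLift e (S.M.obj Kc) y)).left ≪≫ I.univ.fibreCongrPtIso (((𝓜.localise w).left_geomReductionMap_comp_fst (thickeningLift e (S.M.obj Kc) y)).trans (Category.assoc _ _ _).symm) ≪≫ (I.univ.fibreBaseChangeIso (extendPoint (closureValuationSubring (w.adicCompletion F)) (toClosureValuationSubring w) (𝓜.localise w).total ((𝓜.localise w).modelPointsEquiv.symm (thickeningLift e (S.M.obj Kc) y))).left ((geomClosedPointIsoSpecResidueField w).inv.left ≫ (specRingHomι (closureValuationSubring (w.adicCompletion F)) (toClosureValuationSubring w) (IsLocalRing.residue (closureValuationSubring (w.adicCompletion F)))).left)).symm).inv.hom.hom.hom) ≫ qbar = 1) ∧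
      -- (K2₀) for every ideal `𝔞`: `Ker q(Ω̄) ⊆ A_y[𝔞](Ω̄)` on points ⇒ `Ker q̄ ⊆ A_{red₀ y}[𝔞]` on ALL `T`-points (★ currency; `IsIdealTorsionΩ … y 𝔞 Pt` and
      -- `(act₀Of 𝓜 w I.univ I.act r (red₀Of … y)).hom.hom.hom` unfold to the two `.i r` terms by `actΩOf_hom_hom_hom` ∕ `act₀Of_hom_hom_hom` (rfl)); at `𝔞 := 𝔭_w·𝔭_{c•w}` = W3∕W5's `hker`
      (∀ 𝔞 : Ideal (𝓞 F),
        (∀ Pt : ((I.univ.baseChange ((𝓜.localise w).genericIso'.inv.left ≫ pullback.fst (𝓜.localise w).total.hom (specGenericPoint (HeightOneSpectrum.valuationSubringAtPrime F w) F))).baseChange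
            (thickeningLift e (S.M.obj Kc) y).left).toAffine.toAbelianVariety.Points (AlgebraicClosure (w.adicCompletion F)),
          (AlgPoints.map q Pt : B.toAffine.toAbelianVariety.Points (AlgebraicClosure (w.adicCompletion F))) = 1 →
            ∀ r ∈ 𝔞, (AlgPoints.map (((I.act.baseChange ((𝓜.localise w).genericIso'.inv.left ≫ pullback.fst (𝓜.localise w).total.hom (specGenericPoint (HeightOneSpectrum.valuationSubringAtPrime F w) F))).baseChange (thickeningLift e (S.M.obj Kc) y).left).i r) Pt :
              ((I.univ.baseChange ((𝓜.localise w).genericIso'.inv.left ≫ pullback.fst (𝓜.localise w).total.hom (specGenericPoint (HeightOneSpectrum.valuationSubringAtPrime F w) F))).baseChange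
                (thickeningLift e (S.M.obj Kc) y).left).toAffine.toAbelianVariety.Points (AlgebraicClosure (w.adicCompletion F))) = 1) →
        ∀ ⦃T : Over (Spec (.of (geomResidueField w)))⦄ (z : T ⟶ ((I.univ.baseChange (pullback.fst (𝓜.localise w).total.hom (specResidueField w))).baseChange ((𝓜.localise w).geomReductionMap (thickeningLift e (S.M.obj Kc) y)).left).X),
          z ≫ qbar = 1 → ∀ r ∈ 𝔞, z ≫ ((I.act.baseChange (pullback.fst (𝓜.localise w).total.hom (specResidueField w))).baseChange ((𝓜.localise w).geomReductionMap (thickeningLift e (S.M.obj Kc) y)).left).i r = 1) ∧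
      -- (K4₀) degree, (FIN₀) finiteness, (RK₀) `rk Γ(Ker q̄) = #Ker q(Ω̄)` of the reduced leg
      Literature.AlgebraicGeometry.Motives.AbelianVariety.Hom.kerRank (homOfIsMonHom qbar) = Literature.AlgebraicGeometry.Motives.AbelianVariety.Hom.kerRank (homOfIsMonHom q) ∧
      IsFinite qbar.left ∧
      Module.finrank (geomResidueField w) (Literature.AlgebraicGeometry.GroupSchemes.AffineGroupScheme.Alg (Literature.AlgebraicGeometry.GroupSchemes.GroupSchemeKernel.ker qbar)) =
        Nat.card (Literature.AlgebraicGeometry.Motives.AbelianVariety.Hom.kerPoints (specOver (AlgebraicClosure (w.adicCompletion F)) (AlgebraicClosure (w.adicCompletion F))) (homOfIsMonHom q)) := by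
  haveI := I.comm
  haveI : IsProper (𝓜.localise w).total.hom := h𝓨.2
  have hN : I.pChar ≠ 0 := I.hpChar.1.ne_zero
  exact exists_roofLeg_specialFibre_of_downstairsDual_kerRowsFin (K := F) (v := w) (Y := (thickening F Fi).obj (S.M.obj Kc))
    (𝒜 := I.univ) (O := 𝓞 F) (N := I.pChar) (B := B) (J := Fin I.g ⊕ Fin I.g → ZMod I.N) (𝓜.localise w) I.act E' hE' P Q
    (thickeningLift e (S.M.obj Kc) y) (thickeningLift e (S.M.obj Kc) y'') I.dual hD I.pol hN hP hQ hQP hPQ h𝔭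
    I.lvl.section_ q c hr2 DB hDBu lamB hr3q hr3c hr4 hr5


set_option maxHeartbeats 400000 in
/-- (c′) **THE ROOF AND ITS REDUCED LEG IN ONE ∃** (RULING (γ1) «one ∃, one roof downstairs»): from `RoofΩ … y y″ K`, re-export the roof's own witnesses
`B, DB, λ_B, q, c` with the rows (r1)–(r5) VERBATIM (so that consumers read `q`, `K`, (r1) from the SAME `obtain`) AND the reduced leg `q̄` with (b′)'s eight rows —
in particular `hker := (K2₀) (𝔭_w·𝔭_{c•w}) ∘ (r1) ∘` L2's ★ `isIdealTorsion_mul_of_roof`, and `rk Γ(Ker q̄) = #K` from (RK₀) ∘ (r1).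
[cite: Liu2021, Prop. D.8 (3) p. 135, pp. 136–138] [cite: RapoportSmithlingZhang2020Diagonal, §4.3 (4.23) p. 21] [cite: SerreTate1968, §1 Lemma 2] -/
theorem exists_roofLeg_of_roofΩ_kerRows (I : RGDInputsAt F ι₁ Jstar K₀ S hU7ₛ hJ hJu Fi Kc G 𝓜 w hw h𝓨 θ e)
    {m : ℕ} (E' : Matrix (Fin m) (Fin m) (𝓞 F)) (hE' : E' * E' = E') (P : Matrix (Fin m) (Fin 1) (𝓞 F)) (Q : Matrix (Fin 1) (Fin m) (𝓞 F))
    (hP : E' * P = P) (hQ : Q * E' = Q) (hQP : Q * P = Matrix.scalar (Fin 1) (I.pChar : 𝓞 F))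
    (hPQ : P * Q = Matrix.scalar (Fin m) (I.pChar : 𝓞 F) * E') (h𝔭 : Ideal.span (Set.range fun k => P k 0) = w.asIdeal)
    (hD : Nonempty ((Scheme.Modules.pullback (DualPair.unitHatSlice I.dual)).obj I.dual.P ≅ SheafOfModules.unit _))
    (y y'' : AlgPoints (S.M.obj Kc) (AlgebraicClosure (w.adicCompletion F)))
    (K : Subgroup ((fibreΩOf S Kc 𝓜 w e I.univ y).Points (AlgebraicClosure (w.adicCompletion F))))
    (hR : RoofΩ S Kc 𝓜 w e I.univ I.act I.dual I.pol I.lvl I.pChar w.asIdeal y y'' K) :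
    haveI := I.comm
    haveI : IsProper (𝓜.localise w).total.hom := h𝓨.2
    ∃ (B : Literature.AlgebraicGeometry.AbelianSchemes.AbelianSchemeOver (AlgebraicGeometry.Spec (CommRingCat.of (AlgebraicClosure (w.adicCompletion F)))))
      (DB : B.DualPair) (lamB : B.X ⟶ DB.hat.X) (_ : IsMonHom lamB)
      -- J12 INTERFACE PIN (ref1 (g2) e-12): `B̂`'s Poincaré sheaf is normalised along `A × {ε_B̂}` — the unit clause `hD_B` (for a ★ `Polarization` it is ★ `Polarization.nonempty_unitHatSlice_iso`)
      (_ : Nonempty ((AlgebraicGeometry.Scheme.Modules.pullback DB.unitHatSlice).obj DB.P ≅ SheafOfModules.unit _))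
      (q : (schΩOf S Kc 𝓜 w e I.univ y).X ⟶ B.X) (_ : IsMonHom q)
      (c : (schΩOf S Kc 𝓜 w e I.univ y'').X ⟶ B.X) (_ : IsMonHom c),
      -- (r1) kernel of `q` on `Ω`-points
      (∀ P : (fibreΩOf S Kc 𝓜 w e I.univ y).Points (AlgebraicClosure (w.adicCompletion F)),
          (AlgPoints.map q P : B.toAffine.toAbelianVariety.Points (AlgebraicClosure (w.adicCompletion F))) = 1 ↔ P ∈ K) ∧
      -- (r2) kernel of `c` on `Ω`-points = the `𝔞`-torsion; `c` surjective
      (∀ P : (fibreΩOf S Kc 𝓜 w e I.univ y'').Points (AlgebraicClosure (w.adicCompletion F)),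
          (AlgPoints.map c P : B.toAffine.toAbelianVariety.Points (AlgebraicClosure (w.adicCompletion F))) = 1 ↔
            IsIdealTorsionΩ S Kc 𝓜 w e I.univ I.act y'' w.asIdeal P) ∧
      Function.Surjective c.left.base ∧
      -- (r3) polarisations: `q^* λ_B = p • λ_y`, `c^* λ_B = p • λ_y″`
      q ≫ lamB ≫ Literature.AlgebraicGeometry.AbelianSchemes.AbelianSchemeOver.DualPair.dualIsogenyOver q (dualΩOf S Kc 𝓜 w e I.univ I.dual y) DB =
        (polΩOf S Kc 𝓜 w e I.univ I.pol y).lam ≫ (dualΩOf S Kc 𝓜 w e I.univ I.dual y).hat.mulN I.pChar ∧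
      c ≫ lamB ≫ Literature.AlgebraicGeometry.AbelianSchemes.AbelianSchemeOver.DualPair.dualIsogenyOver c (dualΩOf S Kc 𝓜 w e I.univ I.dual y'') DB =
        (polΩOf S Kc 𝓜 w e I.univ I.pol y'').lam ≫ (dualΩOf S Kc 𝓜 w e I.univ I.dual y'').hat.mulN I.pChar ∧
      -- (r4) `𝒪_F`-equivariance through a common endomorphism of `B`
      (∀ a : 𝓞 F, ∃ b : B.X ⟶ B.X,
          (actΩOf S Kc 𝓜 w e I.univ I.act a y).hom.hom.hom ≫ q = q ≫ b ∧ (actΩOf S Kc 𝓜 w e I.univ I.act a y'').hom.hom.hom ≫ c = c ≫ b) ∧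
      -- (r5) level-`N` points correspond
      (∀ a : Fin I.g ⊕ Fin I.g → ZMod I.N,
          (AlgPoints.map q (lvlPtΩOf S Kc 𝓜 w e I.univ I.lvl y a) : B.toAffine.toAbelianVariety.Points (AlgebraicClosure (w.adicCompletion F))) =
            AlgPoints.map c (lvlPtΩOf S Kc 𝓜 w e I.univ I.lvl y'' a)) ∧
      ∃ (qbar : ((I.univ.baseChange (pullback.fst (𝓜.localise w).total.hom (specResidueField w))).baseChange (red₀Of S Kc 𝓜 w h𝓨 e y).left).X ⟶
                 (((serreTensor I.act E' hE').baseChange (pullback.fst (𝓜.localise w).total.hom (specResidueField w))).baseChange (red₀Of S Kc 𝓜 w h𝓨 e y'').left).X)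
        (_ : IsMonHom qbar),
        (Flat qbar.left ∧ Function.Surjective qbar.left.base) ∧
        (∀ a : 𝓞 F, ((I.act.baseChange (pullback.fst (𝓜.localise w).total.hom (specResidueField w))).baseChange (red₀Of S Kc 𝓜 w h𝓨 e y).left).i a ≫ qbar =
          qbar ≫ (((serreAction I.act E' hE').baseChange (pullback.fst (𝓜.localise w).total.hom (specResidueField w))).baseChange (red₀Of S Kc 𝓜 w h𝓨 e y'').left).i a) ∧
        (∀ a : Fin I.g ⊕ Fin I.g → ZMod I.N,
          AlgPoints.map qbar ((I.univ.baseChange (pullback.fst (𝓜.localise w).total.hom (specResidueField w))).restrictPt (red₀Of S Kc 𝓜 w h𝓨 e y).left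
              (I.univ.sectionBaseChange (pullback.fst (𝓜.localise w).total.hom (specResidueField w)) (I.lvl.section_ a))) =
            ((serreTensor I.act E' hE').baseChange (pullback.fst (𝓜.localise w).total.hom (specResidueField w))).restrictPt (red₀Of S Kc 𝓜 w h𝓨 e y'').left
              ((serreTensor I.act E' hE').sectionBaseChange (pullback.fst (𝓜.localise w).total.hom (specResidueField w)) (I.lvl.section_ a ≫ serreTranslate I.act E' hE' P))) ∧
        (∀ (DBs : (((serreTensor I.act E' hE').baseChange (pullback.fst (𝓜.localise w).total.hom (specResidueField w))).baseChange (red₀Of S Kc 𝓜 w h𝓨 e y'').left).DualPair)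
          (_ : Nonempty ((Scheme.Modules.pullback (DualPair.unitHatSlice DBs)).obj DBs.P ≅ SheafOfModules.unit _))
          (lamBs : (((serreTensor I.act E' hE').baseChange (pullback.fst (𝓜.localise w).total.hom (specResidueField w))).baseChange (red₀Of S Kc 𝓜 w h𝓨 e y'').left).X ⟶ DBs.hat.X) [IsMonHom lamBs],
          (haveI := isMonHom_coverLeg (pullback.fst (𝓜.localise w).total.hom (specResidueField w)) (red₀Of S Kc 𝓜 w h𝓨 e y'').left I.act E' hE' P
           baseChangeHom (baseChangeHom (serreTranslate I.act E' hE' P) (pullback.fst (𝓜.localise w).total.hom (specResidueField w))) (red₀Of S Kc 𝓜 w h𝓨 e y'').left ≫ lamBs ≫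
              DualPair.dualIsogenyOver (baseChangeHom (baseChangeHom (serreTranslate I.act E' hE' P) (pullback.fst (𝓜.localise w).total.hom (specResidueField w))) (red₀Of S Kc 𝓜 w h𝓨 e y'').left) ((I.dual.baseChange (pullback.fst (𝓜.localise w).total.hom (specResidueField w))).baseChange (red₀Of S Kc 𝓜 w h𝓨 e y'').left) DBs =
            ((I.pol.baseChange (pullback.fst (𝓜.localise w).total.hom (specResidueField w))).baseChange (red₀Of S Kc 𝓜 w h𝓨 e y'').left).lam ≫ ((I.dual.baseChange (pullback.fst (𝓜.localise w).total.hom (specResidueField w))).baseChange (red₀Of S Kc 𝓜 w h𝓨 e y'').left).hat.mulN I.pChar) →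
          qbar ≫ lamBs ≫ DualPair.dualIsogenyOver qbar ((I.dual.baseChange (pullback.fst (𝓜.localise w).total.hom (specResidueField w))).baseChange (red₀Of S Kc 𝓜 w h𝓨 e y).left) DBs =
            ((I.pol.baseChange (pullback.fst (𝓜.localise w).total.hom (specResidueField w))).baseChange (red₀Of S Kc 𝓜 w h𝓨 e y).left).lam ≫ ((I.dual.baseChange (pullback.fst (𝓜.localise w).total.hom (specResidueField w))).baseChange (red₀Of S Kc 𝓜 w h𝓨 e y).left).hat.mulN I.pChar) ∧
        -- (K3₀) model KILL along a flat `𝒦 ↪ I.univ_ỹ` over `R = 𝒪_Ω̄` (`ỹ := extendPoint … (ℓ_e y)` the `R`-point extending `y` = LS `liftOf`): if `𝒦_η`, read in `A_y` through ★ (d5)'s three-piece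
        -- isomorphism (= LS `isoGenericOf` by `hσΩ`), is killed by the LEG `q`, then `𝒦_s`, read in `sch₀Of … (red₀ y)` (= LS `isoSpecialOf` by `hσκ`), is killed by `q̄` — EXACTLY (KEW) `…_of_kerRow`'s `hK3`
        (∀ (𝒦 : Over (Spec (.of (closureValuationSubring (w.adicCompletion F))))) (incl : 𝒦 ⟶ (I.univ.baseChange (extendPoint (closureValuationSubring (w.adicCompletion F)) (toClosureValuationSubring w) (𝓜.localise w).total ((𝓜.localise w).modelPointsEquiv.symm (thickeningLift e (S.M.obj Kc) y))).left).X) [Flat 𝒦.hom],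
          ((Over.pullback (specFractionFieldι (closureValuationSubring (w.adicCompletion F)) (toClosureValuationSubring w)).left).map incl ≫
              (I.univ.fibreBaseChangeIso ((𝓜.localise w).genericIso'.inv.left ≫ pullback.fst (𝓜.localise w).total.hom (specGenericPoint (HeightOneSpectrum.valuationSubringAtPrime F w) F)) (thickeningLift e (S.M.obj Kc) y).left ≪≫ I.univ.fibreCongrPtIso ((𝓜.localise w).left_specFractionFieldι_comp_extendPoint_modelPointsEquiv_symm (thickeningLift e (S.M.obj Kc) y)).symm ≪≫ (I.univ.fibreBaseChangeIso (extendPoint (closureValuationSubring (w.adicCompletion F)) (toClosureValuationSubring w) (𝓜.localise w).total ((𝓜.localise w).modelPointsEquiv.symm (thickeningLift e (S.M.obj Kc) y))).left (specFractionFieldι (closureValuationSubring (w.adicCompletion F)) (toClosureValuationSubring w)).left).symm).inv.hom.hom.hom) ≫ q = 1 →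
          ((Over.pullback ((geomClosedPointIsoSpecResidueField w).inv.left ≫ (specRingHomι (closureValuationSubring (w.adicCompletion F)) (toClosureValuationSubring w) (IsLocalRing.residue (closureValuationSubring (w.adicCompletion F)))).left)).map incl ≫
              (I.univ.fibreBaseChangeIso (pullback.fst (𝓜.localise w).total.hom (specResidueField w)) ((𝓜.localise w).geomReductionMap (thickeningLift e (S.M.obj Kc) y)).left ≪≫ I.univ.fibreCongrPtIso (((𝓜.localise w).left_geomReductionMap_comp_fst (thickeningLift e (S.M.obj Kc) y)).trans (Category.assoc _ _ _).symm) ≪≫ (I.univ.fibreBaseChangeIso (extendPoint (closureValuationSubring (w.adicCompletion F)) (toClosureValuationSubring w) (𝓜.localise w).total ((𝓜.localise w).modelPointsEquiv.symm (thickeningLift e (S.M.obj Kc) y))).left ((geomClosedPointIsoSpecResidueField w).inv.left ≫ (specRingHomι (closureValuationSubring (w.adicCompletion F)) (toClosureValuationSubring w) (IsLocalRing.residue (closureValuationSubring (w.adicCompletion F)))).left)).symm).inv.hom.hom.hom) ≫ qbar = 1) ∧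
        -- (K2₀) for every ideal `𝔞`: `Ker q(Ω̄) ⊆ A_y[𝔞](Ω̄)` on points ⇒ `Ker q̄ ⊆ A_{red₀ y}[𝔞]` on ALL `T`-points (★ currency; `IsIdealTorsionΩ … y 𝔞 Pt` and
        -- `(act₀Of 𝓜 w I.univ I.act r (red₀Of … y)).hom.hom.hom` unfold to the two `.i r` terms by `actΩOf_hom_hom_hom` ∕ `act₀Of_hom_hom_hom` (rfl)); at `𝔞 := 𝔭_w·𝔭_{c•w}` = W3∕W5's `hker`
        (∀ 𝔞 : Ideal (𝓞 F),
          (∀ Pt : ((I.univ.baseChange ((𝓜.localise w).genericIso'.inv.left ≫ pullback.fst (𝓜.localise w).total.hom (specGenericPoint (HeightOneSpectrum.valuationSubringAtPrime F w) F))).baseChange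
              (thickeningLift e (S.M.obj Kc) y).left).toAffine.toAbelianVariety.Points (AlgebraicClosure (w.adicCompletion F)),
            (AlgPoints.map q Pt : B.toAffine.toAbelianVariety.Points (AlgebraicClosure (w.adicCompletion F))) = 1 →
              ∀ r ∈ 𝔞, (AlgPoints.map (((I.act.baseChange ((𝓜.localise w).genericIso'.inv.left ≫ pullback.fst (𝓜.localise w).total.hom (specGenericPoint (HeightOneSpectrum.valuationSubringAtPrime F w) F))).baseChange (thickeningLift e (S.M.obj Kc) y).left).i r) Pt :
                ((I.univ.baseChange ((𝓜.localise w).genericIso'.inv.left ≫ pullback.fst (𝓜.localise w).total.hom (specGenericPoint (HeightOneSpectrum.valuationSubringAtPrime F w) F))).baseChange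
                  (thickeningLift e (S.M.obj Kc) y).left).toAffine.toAbelianVariety.Points (AlgebraicClosure (w.adicCompletion F))) = 1) →
          ∀ ⦃T : Over (Spec (.of (geomResidueField w)))⦄ (z : T ⟶ ((I.univ.baseChange (pullback.fst (𝓜.localise w).total.hom (specResidueField w))).baseChange (red₀Of S Kc 𝓜 w h𝓨 e y).left).X),
            z ≫ qbar = 1 → ∀ r ∈ 𝔞, z ≫ ((I.act.baseChange (pullback.fst (𝓜.localise w).total.hom (specResidueField w))).baseChange (red₀Of S Kc 𝓜 w h𝓨 e y).left).i r = 1) ∧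
        -- (K4₀) degree, (FIN₀) finiteness, (RK₀) `rk Γ(Ker q̄) = #Ker q(Ω̄)` of the reduced leg
        Literature.AlgebraicGeometry.Motives.AbelianVariety.Hom.kerRank (homOfIsMonHom qbar) = Literature.AlgebraicGeometry.Motives.AbelianVariety.Hom.kerRank (homOfIsMonHom q) ∧
        IsFinite qbar.left ∧
        Module.finrank (geomResidueField w) (Literature.AlgebraicGeometry.GroupSchemes.AffineGroupScheme.Alg (Literature.AlgebraicGeometry.GroupSchemes.GroupSchemeKernel.ker qbar)) =
          Nat.card (Literature.AlgebraicGeometry.Motives.AbelianVariety.Hom.kerPoints (specOver (AlgebraicClosure (w.adicCompletion F)) (AlgebraicClosure (w.adicCompletion F))) (homOfIsMonHom q)) := by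
  obtain ⟨B, DB, lamB, hlamB, hDBu, q, hq, c, hc, hr1, hr2, hcsurj, hr3q, hr3c, hr4, hr5⟩ := hR
  haveI := hlamB
  haveI := hq
  haveI := hc
  have Ha := roofΩ_legs_isFinite_surjective I hD y y'' DB lamB hDBu q c hr2 hcsurj hr3q
  haveI := Ha.1
  haveI := Ha.2.1
  haveI := Ha.2.2
  haveI := I.comm
  haveI : IsProper (𝓜.localise w).total.hom := h𝓨.2
  -- (r5) in the sections currency
  have hr5' : ∀ a : Fin I.g ⊕ Fin I.g → ZMod I.N,
      (AlgPoints.map q ((I.univ.baseChange ((𝓜.localise w).genericIso'.inv.left ≫ pullback.fst (𝓜.localise w).total.hom (specGenericPoint (HeightOneSpectrum.valuationSubringAtPrime F w) F))).restrictPt (thickeningLift e (S.M.obj Kc) y).left (I.univ.sectionBaseChange ((𝓜.localise w).genericIso'.inv.left ≫ pullback.fst (𝓜.localise w).total.hom (specGenericPoint (HeightOneSpectrum.valuationSubringAtPrime F w) F)) (I.lvl.section_ a))) :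
          B.toAffine.toAbelianVariety.Points (AlgebraicClosure (w.adicCompletion F))) =
        AlgPoints.map c ((I.univ.baseChange ((𝓜.localise w).genericIso'.inv.left ≫ pullback.fst (𝓜.localise w).total.hom (specGenericPoint (HeightOneSpectrum.valuationSubringAtPrime F w) F))).restrictPt (thickeningLift e (S.M.obj Kc) y'').left (I.univ.sectionBaseChange ((𝓜.localise w).genericIso'.inv.left ≫ pullback.fst (𝓜.localise w).total.hom (specGenericPoint (HeightOneSpectrum.valuationSubringAtPrime F w) F)) (I.lvl.section_ a))) :=
    fun a => by
      rw [← LevelStructure.baseChange_section_]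
      exact hr5 a
  delta red₀Of
  exact ⟨B, DB, lamB, hlamB, hDBu, q, hq, c, hc, hr1, hr2, hcsurj, hr3q, hr3c, hr4, hr5,
    exists_roofLeg_of_legs_kerRows I E' hE' P Q hP hQ hQP hPQ h𝔭 hD y y'' DB lamB hDBu q c (fun Pt => hr2 Pt) hr3q hr3c hr4 hr5'⟩


/-! (★ re-home, size lint: PART 1 of 2 ends here at tree line :312; the workfile continues, in the same namespace, in `Theorems/F0P6aStubFROBRoofLegs.lean`.) -/

end KernelRows
end Summit.HodgeConjecture.HodgeConjecture.Cruxes.HLiu418.F0P6aStubFROBRoofLegs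
end
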